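import Summits.QuantumFields.YangMills.Theorems.UnitScaleTiltProp7CovIterLambdaHLambdaCurl
import Summits.QuantumFields.YangMills.Theorems.UnitScaleTiltProp7OneStepL2BoundsT3
import HarnessLib

/-!
# Route `UnitScaleTilt`, crux K1 «MinimiserStabilityRegPr» (stmt-QuantumFields-19200), LANE II (QH1)♮ — (QE′-H¹), part 1∕2:
# THE REDUCED TRUE LINEARISATION IS AN `ℓ`-NORMALISED CONTRACTION, AND THE COVARIANT COARSE GRADIENT IN `ℓ²`

Cell `ym3-torus`, width seat `ym3-torus-px22` (gen 6).  THEOREMS ONLY (0 `def`, 0 `sorry`); `--supports stmt-QuantumFields-19200 --as helper`, count-neutral.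
YM₃ on T³ is a ladder rung (R3) — NOT d = 4, NOT infinite volume, NOT a mass gap, NOT the Clay problem; nothing here claims a stub, the crux or the gap.

THE POINT (★p1 g19 LANE II NAMER WORDS №9–№11; px22 g6 LOCATE «(QH1) pencil» (P3)).  The structure identity of the curved N6
(✓`Prop7TrueLinIterStructure.trueLinIter_structure`) splits the true linearised `k`-fold average as `Q_k = G_k + (Λ_k(c₋) − Ū(c)Λ_k(c₊)Ū(c)*)`; part 2∕2
(`UnitScaleTiltProp7TrueLinIterH1RowOfRegPr`) turns this into the `H¹` row of `Q^{E′}` that the (QH1)♮ knit needs.  This file supplies its two elementary rows: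
* §1 `sum_normSq_covCoarseGrad_le` — `Σ_c ‖g(c₋) − V(c)·g(c₊)·V(c)*‖² ≤ 4d·Σ_y ‖g y‖²` (special-unitary transports are isometries; each site is source∕target of `d` bonds).
* §2 ★ `ell_mul_sum_normSq_reduced_le_T3` — at an `SU(2)` background with `dist1(U₀(∂p)) ≤ e·ℓ⁻²`, `10⁶L⁵e ≤ 1`: `ℓ·Σ_c‖G_{K−n}(c)‖² ≤ 9·Σ_b‖Y b‖²` — the REDUCED part
  IS an `ℓ`-normalised contraction (`ρ = L^{−1∕2}` per level, defect exponential `≤ e¹ < 3`; ✓`Prop7TrueLinIterDefect.sqrt_sum_normSq_reduced_sub_lineIter_le`, 2nd conjunct,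
  guards from ✓`Prop7CovIterLambdaBound.tower_plaq_lt` as in ★routeR-w2's ✓p616747).

HONEST SCOPE.  Bookkeeping over landed rows; nothing of (QH1)♮, (REC), `hN06`, EX or the crux is proved here.

References: T. Bałaban, CMP 95 (1984) 17–40 [Balaban1984PropagatorsI] ((1.4) p.18, (1.18)–(1.20) pp.19–20); CMP 98 (1985) 17–51 [Balaban1985Averaging]
(Prop. 2 (53) p.26, (124)–(126) p.36).
-/

noncomputable section

open scoped BigOperators Matrix.Norms.L2Operator Matrix

namespace Summit.QuantumFields.YangMills.Theorems.Prop7TrueLinReducedContraction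

open Literature.MathematicalPhysics.QuantumFieldTheory.Balaban1983to89
open Literature.MathematicalPhysics.QuantumFieldTheory.Balaban1983to89.T3ContinuumYM3Torus
open Finset T4Continuum BlockAveraging AveragingRT ExpMeanLog BlockAveragingEMLLinearised BlockAveragingEMLLinearisedBackground BlockAveragingEMLProp2
open B1RG242Torus
open LatticeWordStokes (dist1_loopHol_le)
open Summit.QuantumFields.YangMills.Theorems.Prop7CovIterLambdaBound (tower_plaq_lt norm_conj_su_le)
open Summit.QuantumFields.YangMills.Theorems.Prop7CovLineIterGrad (theta_lt_deltaSU)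
open Summit.QuantumFields.YangMills.Theorems.Prop7CovLineIterGradT3 (rho_m_eq)
open Summit.QuantumFields.YangMills.Theorems.Prop7TrueLinIterDefect (sqrt_sum_normSq_reduced_sub_lineIter_le)
open Summit.QuantumFields.YangMills.Theorems.Prop7CovIterLambdaHLambda (sum_range_pow_two_mul_le)
open Summit.QuantumFields.YangMills.Theorems.Prop7CovIterLambdaHLambdaBridge (one_div_le_deltaSU sqrt_two_three_cube)
open Summit.QuantumFields.YangMills.Theorems.Prop7OneStepL2Bounds (sum_comp_le_of_injective)

/-! ## §1 The covariant coarse gradient in `ℓ²` -/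

/-- **THE COVARIANT COARSE GRADIENT IN `ℓ²`**: for every transport field `V` of special-unitary matrices and every site field `g`,
`Σ_{c} ‖g(c₋) − V(c)·g(c₊)·V(c)*‖² ≤ 4d·Σ_y ‖g y‖²` (conjugation by `SU(N)` is an operator-norm isometry; every site is the source of `d` bonds and the target of `d` bonds).
[cite: Balaban1984PropagatorsI, (1.4) p.18] -/
theorem sum_normSq_covCoarseGrad_le {P : Params} {N : ℕ} [NeZero N] {k : ℕ} (V : PBond P k → Matrix.specialUnitaryGroup (Fin N) ℂ)
    (g : Site P k → Matrix (Fin N) (Fin N) ℂ) :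
    ∑ c : PBond P k, ‖g c.src - (V c : Matrix (Fin N) (Fin N) ℂ) * g c.tgt * star (V c : Matrix (Fin N) (Fin N) ℂ)‖ ^ 2
      ≤ 4 * (P.d : ℝ) * ∑ y : Site P k, ‖g y‖ ^ 2 := by
  classical
  have shift_injective : ∀ μ : Fin P.d, Function.Injective fun x : Site P k => x.shift μ := fun μ x x' h => by
    simpa only [Site.unshift_shift] using congrArg (fun z : Site P k => z.unshift μ) h
  have h2 : ∀ c : PBond P k, ‖g c.src - (V c : Matrix (Fin N) (Fin N) ℂ) * g c.tgt * star (V c : Matrix (Fin N) (Fin N) ℂ)‖ ^ 2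
      ≤ 2 * ‖g c.src‖ ^ 2 + 2 * ‖g c.tgt‖ ^ 2 := fun c => by
    have hc := norm_conj_su_le (V c) (g c.tgt)
    have h : ‖g c.src - (V c : Matrix (Fin N) (Fin N) ℂ) * g c.tgt * star (V c : Matrix (Fin N) (Fin N) ℂ)‖ ≤ ‖g c.src‖ + ‖g c.tgt‖ :=
      (norm_sub_le _ _).trans (by linarith)
    have ha := norm_nonneg (g c.src)
    have hb := norm_nonneg (g c.tgt)
    have hn := norm_nonneg (g c.src - (V c : Matrix (Fin N) (Fin N) ℂ) * g c.tgt * star (V c : Matrix (Fin N) (Fin N) ℂ))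
    have h' : ‖g c.src - (V c : Matrix (Fin N) (Fin N) ℂ) * g c.tgt * star (V c : Matrix (Fin N) (Fin N) ℂ)‖ ^ 2 ≤ (‖g c.src‖ + ‖g c.tgt‖) ^ 2 :=
      pow_le_pow_left₀ hn h 2
    nlinarith [sq_nonneg (‖g c.src‖ - ‖g c.tgt‖)]
  have hsrc : ∑ c : PBond P k, ‖g c.src‖ ^ 2 = (P.d : ℝ) * ∑ y : Site P k, ‖g y‖ ^ 2 := by
    rw [← (LatticeFieldCalculus.bondEquiv (P := P) (j := k)).sum_comp (fun c : PBond P k => ‖g c.src‖ ^ 2), Fintype.sum_prod_type]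
    simp only [LatticeFieldCalculus.bondEquiv, Equiv.coe_fn_mk, Finset.sum_const, Finset.card_univ, Fintype.card_fin, nsmul_eq_mul, Finset.mul_sum]
  have htgt : ∑ c : PBond P k, ‖g c.tgt‖ ^ 2 ≤ (P.d : ℝ) * ∑ y : Site P k, ‖g y‖ ^ 2 := by
    rw [← (LatticeFieldCalculus.bondEquiv (P := P) (j := k)).sum_comp (fun c : PBond P k => ‖g c.tgt‖ ^ 2), Fintype.sum_prod_type, Finset.sum_comm]
    simp only [LatticeFieldCalculus.bondEquiv, Equiv.coe_fn_mk, PBond.tgt]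
    calc ∑ μ : Fin P.d, ∑ x : Site P k, ‖g (x.shift μ)‖ ^ 2 ≤ ∑ _μ : Fin P.d, ∑ y : Site P k, ‖g y‖ ^ 2 :=
          Finset.sum_le_sum fun μ _ =>
            sum_comp_le_of_injective _ (shift_injective μ) (fun y => ‖g y‖ ^ 2) fun y => by positivity
      _ = (P.d : ℝ) * ∑ y : Site P k, ‖g y‖ ^ 2 := by rw [Finset.sum_const, Finset.card_univ, Fintype.card_fin, nsmul_eq_mul]
  calc ∑ c : PBond P k, ‖g c.src - (V c : Matrix (Fin N) (Fin N) ℂ) * g c.tgt * star (V c : Matrix (Fin N) (Fin N) ℂ)‖ ^ 2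
      ≤ ∑ c : PBond P k, (2 * ‖g c.src‖ ^ 2 + 2 * ‖g c.tgt‖ ^ 2) := Finset.sum_le_sum fun c _ => h2 c
    _ = 2 * ∑ c : PBond P k, ‖g c.src‖ ^ 2 + 2 * ∑ c : PBond P k, ‖g c.tgt‖ ^ 2 := by
        rw [Finset.sum_add_distrib, Finset.mul_sum, Finset.mul_sum]
    _ ≤ 2 * ((P.d : ℝ) * ∑ y : Site P k, ‖g y‖ ^ 2) + 2 * ((P.d : ℝ) * ∑ y : Site P k, ‖g y‖ ^ 2) := by rw [hsrc]; linarith [htgt]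
    _ = 4 * (P.d : ℝ) * ∑ y : Site P k, ‖g y‖ ^ 2 := by ring

/-! ## §2 ★ The reduced family is an `ℓ`-normalised contraction -/

set_option maxHeartbeats 400000 in
-- HEARTBEAT rule (README∕RULING №24 (a)): the displayed `hGs`∕`hSs` recursion binders are ~40 lines; statement elaboration + the by-name row measured > 100k; decl-local.
/-- ★ **`ℓ·Σ‖G_{K−n}‖² ≤ 9·Σ‖Y‖²` ON THE T³ FAMILY** (`SU(2)`): for a background `U₀` with the non-strict (14)-type bound `dist1(U₀(∂p)) ≤ e·(L^{2(K−n)})⁻¹`,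
`0 < e`, `10⁶·L⁵·e ≤ 1`, and the reduced ∕ pure-`LINE` recursion families `G`, `S` of the curved structure theorem (recursions displayed VERBATIM as in
✓`sum_normSq_covIterLambda_le_curl_T3_su2`): the reduced part of the true linearised average contracts by `ρ = L^{−1∕2}` per level in `ℓ²` up to the defect
exponential `exp((κ∕ρ)·Σ_{j<K−n}θ_j) ≤ e¹ < 3` (✓`sqrt_sum_normSq_reduced_sub_lineIter_le`, second conjunct). [cite: Balaban1984PropagatorsI, (1.18)-(1.20) pp.19-20;
Balaban1985Averaging, Prop. 2 (53) p.26] -/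
theorem ell_mul_sum_normSq_reduced_le_T3 (F : T3Family) (n K : ℕ)
    (U₀ : GaugeField (F.P K) 0 (Matrix.specialUnitaryGroup (Fin 2) ℂ)) {ε : ℝ} (hε : 0 < ε)
    (hεL : 1000000 * (F.L : ℝ) ^ 5 * ε ≤ 1)
    (hU : ∀ p : Plaq (F.P K) 0, dist1 (GaugeField.plaqHol U₀ p) ≤ ε * (((F.L : ℝ) ^ (K - n)) ^ 2)⁻¹)
    (Y : PBond (F.P K) 0 → Matrix (Fin 2) (Fin 2) ℂ)
    (G S : (j : ℕ) → PBond (F.P K) j → Matrix (Fin 2) (Fin 2) ℂ) (hG0 : ∀ b, G 0 b = Y b) (hS0 : ∀ b, S 0 b = Y b)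
    (hGs : ∀ (k : ℕ) (c : PBond (F.P K) (k + 1)), G (k + 1) c
      = (fderiv ℂ (eml : (Idx (F.P K) → Matrix (Fin 2) (Fin 2) ℂ) → Matrix (Fin 2) (Fin 2) ℂ)
            (fun i => ((loopHol (Averaging.iter (fun i => blockAvg (P := F.P K) (j := i) (expMeanLogSU (n := Fin 2))) k U₀) c i :
              Matrix.specialUnitaryGroup (Fin 2) ℂ) : Matrix (Fin 2) (Fin 2) ℂ))
            (fun i => covWalkSum (Averaging.iter (fun i => blockAvg (P := F.P K) (j := i) (expMeanLogSU (n := Fin 2))) k U₀) (G k)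
                (walk (emb c.src) (loopWord (F.P K).L c.dir (off i.1) i.2.1 i.2.2))
              * ((loopHol (Averaging.iter (fun i => blockAvg (P := F.P K) (j := i) (expMeanLogSU (n := Fin 2))) k U₀) c i :
                Matrix.specialUnitaryGroup (Fin 2) ℂ) : Matrix (Fin 2) (Fin 2) ℂ))
            * star ((corr (expMeanLogSU (n := Fin 2)) (Averaging.iter (fun i => blockAvg (P := F.P K) (j := i) (expMeanLogSU (n := Fin 2))) k U₀) c :
                Matrix.specialUnitaryGroup (Fin 2) ℂ) : Matrix (Fin 2) (Fin 2) ℂ)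
          + ((corr (expMeanLogSU (n := Fin 2)) (Averaging.iter (fun i => blockAvg (P := F.P K) (j := i) (expMeanLogSU (n := Fin 2))) k U₀) c :
                Matrix.specialUnitaryGroup (Fin 2) ℂ) : Matrix (Fin 2) (Fin 2) ℂ)
            * covWalkSum (Averaging.iter (fun i => blockAvg (P := F.P K) (j := i) (expMeanLogSU (n := Fin 2))) k U₀) (G k)
                (walk (emb c.src) (List.replicate (F.P K).L (c.dir, true)))
            * star ((corr (expMeanLogSU (n := Fin 2)) (Averaging.iter (fun i => blockAvg (P := F.P K) (j := i) (expMeanLogSU (n := Fin 2))) k U₀) c :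
                Matrix.specialUnitaryGroup (Fin 2) ℂ) : Matrix (Fin 2) (Fin 2) ℂ))
        - ((((Fintype.card (Idx (F.P K)) : ℂ))⁻¹ • ∑ i : Idx (F.P K),
              covWalkSum (Averaging.iter (fun i => blockAvg (P := F.P K) (j := i) (expMeanLogSU (n := Fin 2))) k U₀) (G k) (walk (emb c.src) (stairWord i.2.1 (off i.1))))
            - ((Averaging.iter (fun i => blockAvg (P := F.P K) (j := i) (expMeanLogSU (n := Fin 2))) (k + 1) U₀ c : Matrix.specialUnitaryGroup (Fin 2) ℂ) :
                Matrix (Fin 2) (Fin 2) ℂ)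
              * (((Fintype.card (Idx (F.P K)) : ℂ))⁻¹ • ∑ i : Idx (F.P K),
                  covWalkSum (Averaging.iter (fun i => blockAvg (P := F.P K) (j := i) (expMeanLogSU (n := Fin 2))) k U₀) (G k) (walk (emb c.tgt) (stairWord i.2.1 (off i.1))))
              * star ((Averaging.iter (fun i => blockAvg (P := F.P K) (j := i) (expMeanLogSU (n := Fin 2))) (k + 1) U₀ c :
                Matrix.specialUnitaryGroup (Fin 2) ℂ) : Matrix (Fin 2) (Fin 2) ℂ)))
    (hSs : ∀ (k : ℕ) (c : PBond (F.P K) (k + 1)), S (k + 1) c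
      = ((Fintype.card (Idx (F.P K)) : ℂ))⁻¹ • ∑ i : Idx (F.P K),
          ((holAt (Averaging.iter (fun i => blockAvg (P := F.P K) (j := i) (expMeanLogSU (n := Fin 2))) k U₀) (walk (emb c.src) (stairWord i.2.1 (off i.1))) :
              Matrix.specialUnitaryGroup (Fin 2) ℂ) : Matrix (Fin 2) (Fin 2) ℂ) *
            covWalkSum (Averaging.iter (fun i => blockAvg (P := F.P K) (j := i) (expMeanLogSU (n := Fin 2))) k U₀) (S k)
              (walk (walkEnd (emb c.src) (stairWord i.2.1 (off i.1))) (List.replicate (F.P K).L (c.dir, true))) *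
          star ((holAt (Averaging.iter (fun i => blockAvg (P := F.P K) (j := i) (expMeanLogSU (n := Fin 2))) k U₀) (walk (emb c.src) (stairWord i.2.1 (off i.1))) :
              Matrix.specialUnitaryGroup (Fin 2) ℂ) : Matrix (Fin 2) (Fin 2) ℂ)) :
    (F.L : ℝ) ^ (K - n) * ∑ c : PBond (F.P K) (K - n), ‖G (K - n) c‖ ^ 2 ≤ 9 * ∑ b : PBond (F.P K) 0, ‖Y b‖ ^ 2 := by
  have hd : (F.P K).d = 3 := T3ContinuumYM3Torus.T3Family.P_d F K
  have hLF : ((F.P K).L : ℝ) = (F.L : ℝ) := by norm_cast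
  have hL3 : 3 ≤ (F.P K).L := by
    show 3 ≤ F.L
    obtain ⟨⟨m, hm⟩, h1⟩ := F.hL
    omega
  have hk : K - n ≤ (F.P K).m + (F.P K).K := by show K - n ≤ F.m + K; omega
  rw [← hLF] at hεL hU ⊢
  set k := K - n with hkdef
  have hL3r : (3 : ℝ) ≤ (F.P K).L := by exact_mod_cast hL3
  have hL1 : (1 : ℝ) ≤ (F.P K).L := by linarith
  have hL0 : (0 : ℝ) < (F.P K).L := by linarith
  have hLk : (0 : ℝ) < ((F.P K).L : ℝ) ^ k := pow_pos hL0 _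
  have hL5 : (243 : ℝ) ≤ ((F.P K).L : ℝ) ^ 5 := by nlinarith [pow_le_pow_left₀ (by norm_num : (0 : ℝ) ≤ 3) hL3r 5]
  have hL2 : (9 : ℝ) ≤ ((F.P K).L : ℝ) ^ 2 := by nlinarith
  -- the tower's smallness hypotheses at `2ε`
  have hε' : 0 < 2 * ε := by linarith
  have hεs : 243000000 * ε ≤ 1 := by
    have := mul_le_mul_of_nonneg_right hL5 (by positivity : (0 : ℝ) ≤ 1000000 * ε)
    linarith
  have hε3 : (143 * (((((F.P K).d + 4 : ℕ) : ℝ)) ^ 2 / 4) ^ 2) * (2 * ε) ≤ 1 / 3 := by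
    rw [hd, show (143 * ((((3 + 4 : ℕ) : ℝ)) ^ 2 / 4) ^ 2) = 343343 / 16 by norm_num]
    linarith
  have hεL2 : ((F.P K).L : ℝ) ^ 2 * ε * 1000000 ≤ 1 := by
    have h1 : ((F.P K).L : ℝ) ^ 2 ≤ ((F.P K).L : ℝ) ^ 5 := by
      calc ((F.P K).L : ℝ) ^ 2 = ((F.P K).L : ℝ) ^ 2 * 1 := by ring
        _ ≤ ((F.P K).L : ℝ) ^ 2 * ((F.P K).L : ℝ) ^ 3 := mul_le_mul_of_nonneg_left (one_le_pow₀ hL1) (by positivity)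
        _ = ((F.P K).L : ℝ) ^ 5 := by ring
    nlinarith [mul_le_mul_of_nonneg_right h1 (by positivity : (0:ℝ) ≤ ε)]
  have hε2 : 2 * (2 * ε) ≤ 2 * deltaSU (Fin 2) / ((((F.P K).d + 4) * (F.P K).L : ℕ) : ℝ) ^ 2 := by
    have hδ := one_div_le_deltaSU 2
    rw [hd, le_div_iff₀ (by positivity)]
    push_cast
    have h1 : 98 * ((F.P K).L : ℝ) ^ 2 * ε ≤ 1 / (3 * (2 : ℕ)) := by
      rw [le_div_iff₀ (by positivity)]
      push_cast
      nlinarith [hεL2]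
    have e : 2 * (2 * ε) * (7 * ((F.P K).L : ℝ)) ^ 2 = 2 * (98 * ((F.P K).L : ℝ) ^ 2 * ε) := by ring
    rw [e]
    have : (1 : ℝ) / (3 * (2 : ℕ)) ≤ deltaSU (Fin 2) := by exact_mod_cast hδ
    linarith
  have hε24 : ((((F.P K).d + 2) * (F.P K).L : ℕ) : ℝ) ^ 2 / 4 * (2 * (2 * ε)) ≤ 1 / 24 := by
    rw [hd]; push_cast
    have e : ((5 : ℝ) * ((F.P K).L : ℝ)) ^ 2 / 4 * (2 * (2 * ε)) = 25 * (((F.P K).L : ℝ) ^ 2 * ε) := by ring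
    rw [e]
    nlinarith [hεL2]
  have hU' : PlaqSmall ((2 * ε) * ((((F.P K).L : ℝ) ^ k)⁻¹) ^ 2) U₀ := by
    intro p
    have h := hU p
    have hpos : 0 < ε * ((((F.P K).L : ℝ) ^ k) ^ 2)⁻¹ := by positivity
    rw [inv_pow]
    linarith
  -- the level guards `θ_j`
  obtain ⟨θ, hθ⟩ : ∃ θ : ℕ → ℝ, θ = fun j => ((((F.P K).d + 2) * (F.P K).L : ℕ) : ℝ) ^ 2 / 4 * (2 * (2 * ε) * (((F.P K).L : ℝ) ^ j * (((F.P K).L : ℝ) ^ k)⁻¹) ^ 2) :=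
    ⟨_, rfl⟩
  have hθ0 : ∀ j, 0 ≤ θ j := fun j => by rw [hθ]; positivity
  have hθle : ∀ j, j ≤ k → θ j ≤ ((((F.P K).d + 2) * (F.P K).L : ℕ) : ℝ) ^ 2 / 4 * (2 * (2 * ε)) := by
    intro j hj
    rw [hθ]; simp only []
    have hx1 : ((F.P K).L : ℝ) ^ j * (((F.P K).L : ℝ) ^ k)⁻¹ ≤ 1 := by
      rw [mul_inv_le_iff₀ hLk, one_mul]; exact pow_le_pow_right₀ hL1 hj
    have hx0 : 0 ≤ ((F.P K).L : ℝ) ^ j * (((F.P K).L : ℝ) ^ k)⁻¹ := by positivity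
    have : 2 * (2 * ε) * (((F.P K).L : ℝ) ^ j * (((F.P K).L : ℝ) ^ k)⁻¹) ^ 2 ≤ 2 * (2 * ε) :=
      mul_le_of_le_one_right (by positivity) (pow_le_one₀ hx0 hx1)
    exact mul_le_mul_of_nonneg_left this (by positivity)
  have hα : ∀ j, j < k → ∀ (c : PBond (F.P K) (j + 1)) (i : Idx (F.P K)),
      dist1 (loopHol (Averaging.iter (fun i => blockAvg (P := F.P K) (j := i) (expMeanLogSU (n := Fin 2))) j U₀) c i) ≤ θ j := by
    intro j hj c i
    have hpl : PlaqSmall (2 * (2 * ε) * (((F.P K).L : ℝ) ^ j * (((F.P K).L : ℝ) ^ k)⁻¹) ^ 2)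
        (Averaging.iter (fun i => blockAvg (P := F.P K) (j := i) (expMeanLogSU (n := Fin 2))) j U₀) :=
      fun q => (tower_plaq_lt k hε' hε3 hε2 hU' hj.le q).1
    rw [hθ]
    exact dist1_loopHol_le (by positivity) hpl c i
  have ha24 : ∀ j, j < k → θ j ≤ 1 / 24 := fun j hj => (hθle j hj.le).trans hε24
  have haN : ∀ j, j < k → θ j < deltaSU (Fin 2) := fun j hj =>
    lt_of_le_of_lt (hθle j hj.le) (theta_lt_deltaSU (P := F.P K) (n := Fin 2) hε' hε2)
  -- `Σ_{j<k} θ_j ≤ ((d+2)L)²/4 · 2(2ε)` (geometric: `Σ L^{2j} ≤ L^k·L^k`)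
  have hA : ∑ j ∈ range k, θ j ≤ ((((F.P K).d + 2) * (F.P K).L : ℕ) : ℝ) ^ 2 / 4 * (2 * (2 * ε)) := by
    have e : ∑ j ∈ range k, θ j = ((((F.P K).d + 2) * (F.P K).L : ℕ) : ℝ) ^ 2 / 4 * (2 * (2 * ε)) * ((((F.P K).L : ℝ) ^ k)⁻¹) ^ 2
        * ∑ j ∈ range k, (((F.P K).L : ℝ) ^ j) ^ 2 := by
      rw [hθ, Finset.mul_sum]; exact Finset.sum_congr rfl fun j _ => by ring
    rw [e]
    have hgeo := sum_range_pow_two_mul_le (P := F.P K) k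
    have h1 : ((((F.P K).L : ℝ) ^ k)⁻¹) ^ 2 * ∑ j ∈ range k, (((F.P K).L : ℝ) ^ j) ^ 2 ≤ 1 := by
      calc ((((F.P K).L : ℝ) ^ k)⁻¹) ^ 2 * ∑ j ∈ range k, (((F.P K).L : ℝ) ^ j) ^ 2
          ≤ ((((F.P K).L : ℝ) ^ k)⁻¹) ^ 2 * (((F.P K).L : ℝ) ^ k * ((F.P K).L : ℝ) ^ k) := mul_le_mul_of_nonneg_left hgeo (by positivity)
        _ = 1 := by field_simp
    have h0 : 0 ≤ ((((F.P K).d + 2) * (F.P K).L : ℕ) : ℝ) ^ 2 / 4 * (2 * (2 * ε)) := by positivity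
    have h2 := mul_le_mul_of_nonneg_left h1 h0
    have e3 : ((((F.P K).d + 2) * (F.P K).L : ℕ) : ℝ) ^ 2 / 4 * (2 * (2 * ε)) * ((((F.P K).L : ℝ) ^ k)⁻¹) ^ 2 * ∑ j ∈ range k, (((F.P K).L : ℝ) ^ j) ^ 2
        = ((((F.P K).d + 2) * (F.P K).L : ℕ) : ℝ) ^ 2 / 4 * (2 * (2 * ε)) * (((((F.P K).L : ℝ) ^ k)⁻¹) ^ 2 * ∑ j ∈ range k, (((F.P K).L : ℝ) ^ j) ^ 2) := by ring
    rw [e3]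
    linarith
  -- the reduced bound
  obtain ⟨_, hGm⟩ := sqrt_sum_normSq_reduced_sub_lineIter_le U₀ Y G S hG0 hS0 hGs hSs θ hθ0 hk hα ha24 haN
  rw [rho_m_eq hd] at hGm
  -- the exponential factor is at most `e¹ ≤ 3`
  set κ' : ℝ := 159 * ((((F.P K).d + 2) * (F.P K).L : ℕ) : ℝ) * Real.sqrt (2 * (F.P K).d * ((F.P K).L : ℝ) ^ (F.P K).d * (2 * (F.P K).d)) with hκ'
  have hsL : 0 < Real.sqrt (F.P K).L := Real.sqrt_pos.mpr hL0
  have hs2 : Real.sqrt ((F.P K).L : ℝ) ^ 2 = (F.P K).L := Real.sq_sqrt hL0.le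
  have hκ'eq : κ' = 159 * (5 * ((F.P K).L : ℝ)) * (6 * ((F.P K).L : ℝ) * Real.sqrt (F.P K).L) := by
    rw [hκ', hd]; push_cast
    rw [show (2 * (3 : ℝ) * ((F.P K).L : ℝ) ^ 3 * (2 * 3)) = 2 * 3 * ((F.P K).L : ℝ) ^ 3 * (2 * 3) by ring, sqrt_two_three_cube _ hL0.le]
  have hexp : Real.exp (κ' / (Real.sqrt (F.P K).L)⁻¹ * ∑ j ∈ range k, θ j) ≤ 3 := by
    have hx : κ' / (Real.sqrt (F.P K).L)⁻¹ * ∑ j ∈ range k, θ j ≤ 1 := by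
      rw [div_inv_eq_mul, hκ'eq]
      have hθs := hA
      rw [hd] at hθs; push_cast at hθs
      have e1 : 159 * (5 * ((F.P K).L : ℝ)) * (6 * ((F.P K).L : ℝ) * Real.sqrt (F.P K).L) * Real.sqrt (F.P K).L
          = 4770 * ((F.P K).L : ℝ) ^ 3 := by
        have : Real.sqrt ((F.P K).L : ℝ) * Real.sqrt (F.P K).L = (F.P K).L := by rw [← sq, hs2]
        calc 159 * (5 * ((F.P K).L : ℝ)) * (6 * ((F.P K).L : ℝ) * Real.sqrt (F.P K).L) * Real.sqrt (F.P K).L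
            = 4770 * ((F.P K).L : ℝ) ^ 2 * (Real.sqrt ((F.P K).L : ℝ) * Real.sqrt (F.P K).L) := by ring
          _ = 4770 * ((F.P K).L : ℝ) ^ 3 := by rw [this]; ring
      rw [e1]
      have hs0 : 0 ≤ ∑ j ∈ range k, θ j := Finset.sum_nonneg fun j _ => hθ0 j
      have e2 : ((5 : ℝ) * ((F.P K).L : ℝ)) ^ 2 / 4 * (2 * (2 * ε)) = 25 * ((F.P K).L : ℝ) ^ 2 * ε := by ring
      rw [e2] at hθs
      calc 4770 * ((F.P K).L : ℝ) ^ 3 * ∑ j ∈ range k, θ j ≤ 4770 * ((F.P K).L : ℝ) ^ 3 * (25 * ((F.P K).L : ℝ) ^ 2 * ε) :=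
            mul_le_mul_of_nonneg_left hθs (by positivity)
        _ = 119250 * (((F.P K).L : ℝ) ^ 5 * ε) := by ring
        _ ≤ 1 := by nlinarith [hεL]
    calc Real.exp (κ' / (Real.sqrt (F.P K).L)⁻¹ * ∑ j ∈ range k, θ j) ≤ Real.exp 1 := Real.exp_le_exp.mpr hx
      _ ≤ 3 := by have := Real.exp_one_lt_d9; linarith
  -- square and multiply by `L^k`
  set M : ℝ := Real.sqrt (∑ b : PBond (F.P K) 0, ‖Y b‖ ^ 2) with hM
  have hM0 : 0 ≤ M := Real.sqrt_nonneg _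
  have hY0 : 0 ≤ ∑ b : PBond (F.P K) 0, ‖Y b‖ ^ 2 := Finset.sum_nonneg fun _ _ => sq_nonneg _
  have hGm' : Real.sqrt (∑ c : PBond (F.P K) k, ‖G k c‖ ^ 2) ≤ (Real.sqrt (F.P K).L)⁻¹ ^ k * 3 * M := by
    refine hGm.trans ?_
    have h0 : 0 ≤ (Real.sqrt (F.P K).L)⁻¹ ^ k := pow_nonneg (inv_nonneg.mpr hsL.le) _
    have h1 := mul_le_mul_of_nonneg_left hexp h0
    exact mul_le_mul_of_nonneg_right h1 hM0
  have hG0' : 0 ≤ ∑ c : PBond (F.P K) k, ‖G k c‖ ^ 2 := Finset.sum_nonneg fun _ _ => sq_nonneg _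
  have hsq : ∑ c : PBond (F.P K) k, ‖G k c‖ ^ 2 ≤ ((Real.sqrt (F.P K).L)⁻¹ ^ k * 3 * M) ^ 2 := by
    rw [← Real.sq_sqrt hG0']
    exact pow_le_pow_left₀ (Real.sqrt_nonneg _) hGm' 2
  have hpk : ((Real.sqrt (F.P K).L)⁻¹ ^ k) ^ 2 * ((F.P K).L : ℝ) ^ k = 1 := by
    rw [← pow_mul, mul_comm k 2, pow_mul, inv_pow, hs2, ← mul_pow, inv_mul_cancel₀ hL0.ne', one_pow]
  calc ((F.P K).L : ℝ) ^ k * ∑ c : PBond (F.P K) k, ‖G k c‖ ^ 2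
      ≤ ((F.P K).L : ℝ) ^ k * ((Real.sqrt (F.P K).L)⁻¹ ^ k * 3 * M) ^ 2 := mul_le_mul_of_nonneg_left hsq hLk.le
    _ = 9 * (((Real.sqrt (F.P K).L)⁻¹ ^ k) ^ 2 * ((F.P K).L : ℝ) ^ k) * M ^ 2 := by ring
    _ = 9 * ∑ b : PBond (F.P K) 0, ‖Y b‖ ^ 2 := by rw [hpk, mul_one, hM, Real.sq_sqrt hY0]

end Summit.QuantumFields.YangMills.Theorems.Prop7TrueLinReducedContraction

end
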